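import Summits.QuantumFields.BalabanUV.T4Continuum.Support.NE3HessForm
import Summits.QuantumFields.BalabanUV.T4Continuum.Support.AveragingDeficitNearIdentity
import Literature.MathematicalPhysics.QuantumFieldTheory.Balaban1983to89.T4TiltOscillation

/-!
# T⁴ programme, node NE3 — THE DIAGONAL OF THE WILSON HESSIAN IN B9 (3.10) SHAPE: `hess V X X = ‖d_V X‖²_{HS∕N} −
# Re tr[(dcurl + (d_V X)²)·(V(∂p) − 1)]`, the trace identity `Re tr dcurl V X X = 0`, and the small-field lower bound
# `hess V X X W ≥ (1∕N)·Σ_p ‖(d_V X)(p)‖² − 7a·Σ_p Σ_{b⊂∂p} ‖X(b)‖²`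

First generation of the NE3 prover lineage P3 of the cell `pub-balaban` (unit `b2b-balaban-t4-ne3-p3`; co-owner #3 of
`BINDER-OWNERS.md` row NE3), second file of the `Support/NE3Hess*` family owned by this unit under the P2∕P3 shared-file
agreement (CLAIMS.log l.5380 ∕ l.5549).  Skeleton `HOME/t4/skeletons/NE3-t4-ne3-p3.md` leaves L5∕L6 (route P3) = route
P2's L5c∕L6(b) (`t4/skeletons/NE3-t4-ne3-p2.md`): the STRUCTURE of the second variation that the tangent-coercivity
input `TangentCoercive` and the continuity constant consume.

WHAT IS PROVED ([folklore] matrix algebra + elementary inequalities over the tree's objects; no Bałaban-specific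
hypothesis beyond `IsUnitaryCfg`, `IsSkewDir`, `SmallField`):
§1 trace facts: `Re tr (Ad_u(PQ − QP)) = 0`, hence **`nReTr_dcurlAt_self : Re tr (dcurlAt V X X p′) = 0`** — every
   term of the derivative of the dressed curl in its own direction is a transported commutator;
§2 for skew `K`: `−Re tr(K·K)∕N… = nhsNormSq K ≥ ‖K‖²∕N` (Hilbert–Schmidt square of the tree's `MatrixNorms`);
   `curlAt_mem_skewAdjoint` (unitary `V`, skew `X`);
§3 **`hessPlaqAt_self_eq`** (the B9 (3.10) shape, as an IDENTITY):
   `hessPlaqAt V X X p′ = nhsNormSq ((d_V X)(p′)) − Re tr[(dcurlAt V X X p′ + (d_V X)(p′)²)·(V(∂p′) − 1)]`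
   — the first term is «⟨A, D*DA⟩», the second is «⟨A, Δ′A⟩» with its two printed pieces (the `(Re U(∂p) − 1)`-weighted
   square of the curl and the `Im U(∂p)`-weighted commutators), [Balaban1985BackgroundPropagators] (3.10) p. 391 as
   context;
§4 bounds: `‖dcurlAt V X X p′‖ ≤ 3·Σ_{b⊂∂p′}‖X(b)‖²`, `‖(d_V X)(p′)‖ ≤ Σ_{b⊂∂p′}‖X(b)‖`, hence
   **`hessPlaqAt_self_ge`**: `hessPlaqAt V X X p′ ≥ ‖(d_V X)(p′)‖²∕N − 7·‖V(∂p′) − 1‖·Σ_{b⊂∂p′}‖X(b)‖²`, and summed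
   over a window under `SmallField V a`: **`hess_self_ge`**:
   `hess V X X W ≥ (1∕N)·Σ_{p∈W} ‖curl V X p‖² − 7a·Σ_{p∈W} bondSq X p` (`bondSq` = the four-bond square sum).
The curl term is the coercive part (controlled on the tangent space by the cell's ML ∕ the tree's flat
`B6Cov2156Torus.lowerOnConstrainedT_of_represents`); the `7a` term is the mass-type «curvature–commutator» slack that
forces a divergence (Landau) condition on the direction — skeleton §4 (R0) of route P3, risk R1 of route P2.

HONEST FRAMING.  Finite-T⁴ ultraviolet bookkeeping (rung (B)+1); identities and elementary inequalities; NOTHING is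
asserted about Bałaban's minimisers or NE3; no conditional of the cell (`BetaPertH`, (B), (B^μ)) is used or hidden;
NOT infinite volume, NOT a mass gap, NOT Clay, NOT summit progress.  ABSOLUTE RULE kept: no printed sentence is a
hypothesis.  PLACEMENT: our lemmas under `Summits/QuantumFields/BalabanUV/`; imports `Support.NE3HessForm` (this
unit) and row NE3-R2's `Support.AveragingDeficitNearIdentity` (for `nReTr_Ad`, `abs_nReTr_mul_le`, `norm_Ad_of_unitary`,
`Ad_mem_skewAdjoint`, `val_inv_eq_star_of_unitary`) BY NAME; moves nothing.
-/

set_option autoImplicit false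

open scoped BigOperators Matrix Matrix.Norms.L2Operator
open NormedSpace Finset

namespace Summit.QuantumFields.BalabanUV.T4Continuum.NE3HessBounds

open Literature.MathematicalPhysics.QuantumFieldTheory.Balaban1983to89
open B7Prop1Explicit B7Prop2Explicit MatrixLog UnitaryModel MatrixNorms
open T4AveragingDeficitWall hiding Site Plane Plaq Bond
open AveragingDeficitTransport (norm_Ad_of_unitary Ad_mem_skewAdjoint val_inv_eq_star_of_unitary
  nReTr_eq_zero_of_mem_skewAdjoint)
open AveragingDeficitNearIdentity (nReTr_Ad abs_nReTr_mul_le)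
open NE3HessForm

noncomputable section

variable {d : ℕ} {n : Type*} [Fintype n] [DecidableEq n]

/-! ## §1 Trace facts: transported commutators are traceless -/

omit [DecidableEq n] in
/-- `Re tr (PQ) = Re tr (QP)` (normalised). [folklore] -/
theorem nReTr_mul_comm (P Q : Matrix n n ℂ) : nReTr (P * Q) = nReTr (Q * P) := by
  rw [nReTr, nReTr, Matrix.trace_mul_comm]

omit [DecidableEq n] in
/-- `Re tr (−P) = −Re tr P`. [folklore] -/
theorem nReTr_neg' (P : Matrix n n ℂ) : nReTr (-P) = -nReTr P := by
  simp only [nReTr, Matrix.trace_neg, Complex.neg_re, neg_div]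

/-- A transported commutator is traceless: `Re tr (Ad_u (PQ − QP)) = 0`. [folklore] -/
theorem nReTr_Ad_comm (u : (Matrix n n ℂ)ˣ) (P Q : Matrix n n ℂ) : nReTr (Ad u (P * Q - Q * P)) = 0 := by
  rw [nReTr_Ad, T4TiltOscillation.nReTr_sub, nReTr_mul_comm, sub_self]

/-- **`Re tr (dcurlAt V X X p′) = 0`**: in its own direction the derivative of the dressed curl is a sum of
transported commutators. [folklore] -/
theorem nReTr_dcurlAt_self (V : Site d → Fin d → (Matrix n n ℂ)ˣ) (X : Site d → Fin d → Matrix n n ℂ) (z : Site d) (μ ν : Fin d) :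
    nReTr (dcurlAt V X X z μ ν) = 0 := by
  simp only [dcurlAt, T4TiltOscillation.nReTr_add, T4TiltOscillation.nReTr_sub, nReTr_Ad_comm]
  ring

/-! ## §2 Skew directions: the Hilbert–Schmidt square and the skewness of the dressed curl -/

omit [DecidableEq n] in
/-- For skew `K`: `−Re tr(K K)∕N = nhsNormSq K` (`= Σ|K_{ij}|²∕N`). [folklore] -/
theorem neg_nReTr_mul_self_of_skew {K : Matrix n n ℂ} (hK : K ∈ skewAdjoint (Matrix n n ℂ)) : -nReTr (K * K) = nhsNormSq K := by
  rcases isEmpty_or_nonempty n with hn | hn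
  · simp [nReTr, nhsNormSq, Matrix.trace]
  have hs : star K = -K := skewAdjoint.mem_iff.mp hK
  have h1 : Kᴴ * K = -(K * K) := by
    rw [← Matrix.star_eq_conjTranspose, hs, neg_mul]
  have h2 : (Fintype.card n : ℝ) * nhsNormSq K = (Kᴴ * K).trace.re := by
    rw [card_mul_nhsNormSq, sum_norm_sq_eq_re_trace]
  have hN : (Fintype.card n : ℝ) ≠ 0 := Nat.cast_ne_zero.mpr Fintype.card_ne_zero
  rw [h1, Matrix.trace_neg, Complex.neg_re] at h2
  simp only [nReTr]
  field_simp
  linarith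

/-- `‖K‖²∕N ≤ nhsNormSq K` (operator norm against the normalised Hilbert–Schmidt square). [folklore] -/
theorem opNorm_sq_div_card_le_nhsNormSq [Nonempty n] (K : Matrix n n ℂ) :
    ‖K‖ ^ 2 / (Fintype.card n : ℝ) ≤ nhsNormSq K := by
  have hN : (0 : ℝ) < Fintype.card n := Nat.cast_pos.mpr Fintype.card_pos
  rw [div_le_iff₀ hN, mul_comm]
  exact opNorm_sq_le_card_mul_nhsNormSq K

/-- The dressed curl of a skew direction at a unitary configuration is skew (all `μ, ν`). [folklore] -/
theorem curlAt_mem_skewAdjoint {V : Site d → Fin d → (Matrix n n ℂ)ˣ} (hV : IsUnitaryCfg V) {X : Site d → Fin d → Matrix n n ℂ}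
    (hX : IsSkewDir X) (z : Site d) (μ ν : Fin d) : curlAt V X z μ ν ∈ skewAdjoint (Matrix n n ℂ) := by
  have hu1 : V z μ ∈ unitaryUnits (Matrix n n ℂ) := hV z μ
  have hu12 : V z μ * V (z + e μ) ν ∈ unitaryUnits (Matrix n n ℂ) := (unitaryUnits (Matrix n n ℂ)).mul_mem (hV z μ) (hV (z + e μ) ν)
  have hu123 : V z μ * V (z + e μ) ν * (V (z + e ν) μ)⁻¹ ∈ unitaryUnits (Matrix n n ℂ) :=
    (unitaryUnits (Matrix n n ℂ)).mul_mem hu12 ((unitaryUnits (Matrix n n ℂ)).inv_mem (hV (z + e ν) μ))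
  unfold curlAt
  refine (skewAdjoint (Matrix n n ℂ)).sub_mem ((skewAdjoint (Matrix n n ℂ)).sub_mem ((skewAdjoint (Matrix n n ℂ)).add_mem ?_ ?_) ?_) ?_
  · exact Ad_mem_skewAdjoint hu1 (hX z μ)
  · exact Ad_mem_skewAdjoint hu12 (hX (z + e μ) ν)
  · exact Ad_mem_skewAdjoint hu12 (hX (z + e ν) μ)
  · exact Ad_mem_skewAdjoint hu123 (hX z ν)

/-! ## §3 The diagonal of the Hessian density in B9 (3.10) shape -/

/-- **THE (3.10) SHAPE OF THE DIAGONAL (identity).**  For unitary `V` and skew `X`: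
`hessPlaqAt V X X p′ = nhsNormSq ((d_V X)(p′)) − Re tr[(dcurlAt V X X p′ + (d_V X)(p′)·(d_V X)(p′))·(V(∂p′) − 1)]`.
The first term is the «`⟨A, D*DA⟩`» density, the second the «`⟨A, Δ′A⟩`» density (it vanishes at `V(∂p′) = 1`).
[folklore] [cite: Balaban1985BackgroundPropagators, (3.10) p. 391 (context: the printed split Δ = D*D + Δ′)] -/
theorem hessPlaqAt_self_eq {V : Site d → Fin d → (Matrix n n ℂ)ˣ} (hV : IsUnitaryCfg V) {X : Site d → Fin d → Matrix n n ℂ}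
    (hX : IsSkewDir X) (z : Site d) (μ ν : Fin d) :
    hessPlaqAt V X X z μ ν
      = nhsNormSq (curlAt V X z μ ν)
        - nReTr ((dcurlAt V X X z μ ν + curlAt V X z μ ν * curlAt V X z μ ν)
            * (((hol V z (plaqWord μ ν) : (Matrix n n ℂ)ˣ) : Matrix n n ℂ) - 1)) := by
  set D := dcurlAt V X X z μ ν
  set C := curlAt V X z μ ν
  set H := ((hol V z (plaqWord μ ν) : (Matrix n n ℂ)ˣ) : Matrix n n ℂ)
  have hsplit : (D + C * C) * H = (D + C * C) * (H - 1) + (D + C * C) := by noncomm_ring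
  have hskew : -nReTr (C * C) = nhsNormSq C := neg_nReTr_mul_self_of_skew (curlAt_mem_skewAdjoint hV hX z μ ν)
  have hD : nReTr D = 0 := nReTr_dcurlAt_self V X z μ ν
  simp only [hessPlaqAt]
  rw [hsplit, T4TiltOscillation.nReTr_add, T4TiltOscillation.nReTr_add, hD]
  linarith

/-! ## §4 Elementary bounds and the small-field lower bound -/

/-- The four-bond square sum `Σ_{b⊂∂p′} ‖X(b)‖²` of a direction at the plaquette `(z; μ, ν)`. [folklore] -/
def bondSqAt (X : Site d → Fin d → Matrix n n ℂ) (z : Site d) (μ ν : Fin d) : ℝ :=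
  ‖X z μ‖ ^ 2 + ‖X (z + e μ) ν‖ ^ 2 + ‖X (z + e ν) μ‖ ^ 2 + ‖X z ν‖ ^ 2

/-- `bondSqAt` on indexed plaquettes. [folklore] -/
def bondSq (X : Site d → Fin d → Matrix n n ℂ) (p : T4AveragingDeficitWall.Plaq d) : ℝ := bondSqAt X p.1 p.2.1.1 p.2.1.2

/-- `‖(d_V X)(p′)‖ ≤ Σ_{b⊂∂p′} ‖X(b)‖` for unitary `V`. [folklore] -/
theorem norm_curlAt_le {V : Site d → Fin d → (Matrix n n ℂ)ˣ} (hV : IsUnitaryCfg V) (X : Site d → Fin d → Matrix n n ℂ) (z : Site d)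
    (μ ν : Fin d) :
    ‖curlAt V X z μ ν‖ ≤ ‖X z μ‖ + ‖X (z + e μ) ν‖ + ‖X (z + e ν) μ‖ + ‖X z ν‖ := by
  have hu1 : V z μ ∈ unitaryUnits (Matrix n n ℂ) := hV z μ
  have hu12 : V z μ * V (z + e μ) ν ∈ unitaryUnits (Matrix n n ℂ) := (unitaryUnits (Matrix n n ℂ)).mul_mem (hV z μ) (hV (z + e μ) ν)
  have hu123 : V z μ * V (z + e μ) ν * (V (z + e ν) μ)⁻¹ ∈ unitaryUnits (Matrix n n ℂ) :=
    (unitaryUnits (Matrix n n ℂ)).mul_mem hu12 ((unitaryUnits (Matrix n n ℂ)).inv_mem (hV (z + e ν) μ))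
  unfold curlAt
  set A := Ad (V z μ) (X z μ)
  set B := Ad (V z μ * V (z + e μ) ν) (X (z + e μ) ν)
  set C := Ad (V z μ * V (z + e μ) ν) (X (z + e ν) μ)
  set D := Ad (V z μ * V (z + e μ) ν * (V (z + e ν) μ)⁻¹) (X z ν)
  have hA : ‖A‖ = ‖X z μ‖ := norm_Ad_of_unitary hu1 _
  have hB : ‖B‖ = ‖X (z + e μ) ν‖ := norm_Ad_of_unitary hu12 _
  have hC : ‖C‖ = ‖X (z + e ν) μ‖ := norm_Ad_of_unitary hu12 _
  have hD : ‖D‖ = ‖X z ν‖ := norm_Ad_of_unitary hu123 _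
  have h1 : ‖A + B - C - D‖ ≤ ‖A + B - C‖ + ‖D‖ := norm_sub_le _ _
  have h2 : ‖A + B - C‖ ≤ ‖A + B‖ + ‖C‖ := norm_sub_le _ _
  have h3 : ‖A + B‖ ≤ ‖A‖ + ‖B‖ := norm_add_le _ _
  linarith

/-- `‖(d_V X)(p′)‖² ≤ 4·Σ_{b⊂∂p′}‖X(b)‖²`. [folklore] -/
theorem norm_curlAt_sq_le {V : Site d → Fin d → (Matrix n n ℂ)ˣ} (hV : IsUnitaryCfg V) (X : Site d → Fin d → Matrix n n ℂ) (z : Site d)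
    (μ ν : Fin d) : ‖curlAt V X z μ ν‖ ^ 2 ≤ 4 * bondSqAt X z μ ν := by
  have h := norm_curlAt_le hV X z μ ν
  have h0 : 0 ≤ ‖curlAt V X z μ ν‖ := norm_nonneg _
  unfold bondSqAt
  nlinarith [sq_nonneg (‖X z μ‖ - ‖X (z + e μ) ν‖), sq_nonneg (‖X z μ‖ - ‖X (z + e ν) μ‖),
    sq_nonneg (‖X z μ‖ - ‖X z ν‖), sq_nonneg (‖X (z + e μ) ν‖ - ‖X (z + e ν) μ‖),
    sq_nonneg (‖X (z + e μ) ν‖ - ‖X z ν‖), sq_nonneg (‖X (z + e ν) μ‖ - ‖X z ν‖),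
    norm_nonneg (X z μ), norm_nonneg (X (z + e μ) ν), norm_nonneg (X (z + e ν) μ), norm_nonneg (X z ν)]

/-- `‖PQ − QP‖ ≤ 2‖P‖‖Q‖`. [folklore] -/
theorem norm_comm_le (P Q : Matrix n n ℂ) : ‖P * Q - Q * P‖ ≤ 2 * (‖P‖ * ‖Q‖) := by
  calc ‖P * Q - Q * P‖ ≤ ‖P * Q‖ + ‖Q * P‖ := norm_sub_le _ _
    _ ≤ ‖P‖ * ‖Q‖ + ‖Q‖ * ‖P‖ := add_le_add (opNorm_mul_le _ _) (opNorm_mul_le _ _)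
    _ = 2 * (‖P‖ * ‖Q‖) := by ring

/-- **`‖dcurlAt V X X p′‖ ≤ 3·Σ_{b⊂∂p′}‖X(b)‖²`** for unitary `V` (each commutator `≤ 2‖X_b‖‖X_{b′}‖ ≤ ‖X_b‖² +
‖X_{b′}‖²`, six bond pairs, each bond in three pairs). [folklore] -/
theorem norm_dcurlAt_self_le {V : Site d → Fin d → (Matrix n n ℂ)ˣ} (hV : IsUnitaryCfg V) (X : Site d → Fin d → Matrix n n ℂ)
    (z : Site d) (μ ν : Fin d) : ‖dcurlAt V X X z μ ν‖ ≤ 3 * bondSqAt X z μ ν := by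
  have hu1 : V z μ ∈ unitaryUnits (Matrix n n ℂ) := hV z μ
  have hu2 : V (z + e μ) ν ∈ unitaryUnits (Matrix n n ℂ) := hV (z + e μ) ν
  have hu3i : (V (z + e ν) μ)⁻¹ ∈ unitaryUnits (Matrix n n ℂ) := (unitaryUnits (Matrix n n ℂ)).inv_mem (hV (z + e ν) μ)
  have hu12 : V z μ * V (z + e μ) ν ∈ unitaryUnits (Matrix n n ℂ) := (unitaryUnits (Matrix n n ℂ)).mul_mem hu1 hu2
  have hu23 : V (z + e μ) ν * (V (z + e ν) μ)⁻¹ ∈ unitaryUnits (Matrix n n ℂ) := (unitaryUnits (Matrix n n ℂ)).mul_mem hu2 hu3i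
  have ha : 0 ≤ ‖X z μ‖ := norm_nonneg _
  have hb : 0 ≤ ‖X (z + e μ) ν‖ := norm_nonneg _
  have hc : 0 ≤ ‖X (z + e ν) μ‖ := norm_nonneg _
  have hf : 0 ≤ ‖X z ν‖ := norm_nonneg _
  -- term by term
  have t1 : ‖Ad (V z μ) (X z μ * X z μ - X z μ * X z μ)‖ = 0 := by simp [Ad]
  have t2a : ‖Ad (V z μ) (X z μ * Ad (V (z + e μ) ν) (X (z + e μ) ν)
      - Ad (V (z + e μ) ν) (X (z + e μ) ν) * X z μ)‖ ≤ 2 * (‖X z μ‖ * ‖X (z + e μ) ν‖) := by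
    rw [norm_Ad_of_unitary hu1, ← norm_Ad_of_unitary hu2 (X (z + e μ) ν)]
    exact norm_comm_le _ _
  have t2b : ‖Ad (V z μ * V (z + e μ) ν) (X (z + e μ) ν * X (z + e μ) ν - X (z + e μ) ν * X (z + e μ) ν)‖ = 0 := by
    simp [Ad]
  have t3a : ‖Ad (V z μ) (X z μ * Ad (V (z + e μ) ν) (X (z + e ν) μ)
      - Ad (V (z + e μ) ν) (X (z + e ν) μ) * X z μ)‖ ≤ 2 * (‖X z μ‖ * ‖X (z + e ν) μ‖) := by
    rw [norm_Ad_of_unitary hu1, ← norm_Ad_of_unitary hu2 (X (z + e ν) μ)]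
    exact norm_comm_le _ _
  have t3b : ‖Ad (V z μ * V (z + e μ) ν) (X (z + e μ) ν * X (z + e ν) μ - X (z + e ν) μ * X (z + e μ) ν)‖
      ≤ 2 * (‖X (z + e μ) ν‖ * ‖X (z + e ν) μ‖) := by
    rw [norm_Ad_of_unitary hu12]
    exact norm_comm_le _ _
  have t4a : ‖Ad (V z μ) (X z μ * Ad (V (z + e μ) ν * (V (z + e ν) μ)⁻¹) (X z ν)
      - Ad (V (z + e μ) ν * (V (z + e ν) μ)⁻¹) (X z ν) * X z μ)‖ ≤ 2 * (‖X z μ‖ * ‖X z ν‖) := by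
    rw [norm_Ad_of_unitary hu1, ← norm_Ad_of_unitary hu23 (X z ν)]
    exact norm_comm_le _ _
  have t4b : ‖Ad (V z μ * V (z + e μ) ν) ((X (z + e μ) ν - X (z + e ν) μ) * Ad (V (z + e ν) μ)⁻¹ (X z ν)
      - Ad (V (z + e ν) μ)⁻¹ (X z ν) * (X (z + e μ) ν - X (z + e ν) μ))‖
      ≤ 2 * ((‖X (z + e μ) ν‖ + ‖X (z + e ν) μ‖) * ‖X z ν‖) := by
    rw [norm_Ad_of_unitary hu12]
    refine (norm_comm_le _ _).trans ?_
    rw [norm_Ad_of_unitary hu3i]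
    have h1 : ‖X (z + e μ) ν - X (z + e ν) μ‖ ≤ ‖X (z + e μ) ν‖ + ‖X (z + e ν) μ‖ := norm_sub_le _ _
    exact mul_le_mul_of_nonneg_left (mul_le_mul_of_nonneg_right h1 hf) (by norm_num)
  -- assemble with the triangle inequality along the structure of `dcurlAt`
  have hsum : ‖dcurlAt V X X z μ ν‖ ≤ 0 + (2 * (‖X z μ‖ * ‖X (z + e μ) ν‖) + 0)
      + (2 * (‖X z μ‖ * ‖X (z + e ν) μ‖) + 2 * (‖X (z + e μ) ν‖ * ‖X (z + e ν) μ‖))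
      + (2 * (‖X z μ‖ * ‖X z ν‖) + 2 * ((‖X (z + e μ) ν‖ + ‖X (z + e ν) μ‖) * ‖X z ν‖)) := by
    unfold dcurlAt
    set T1 := Ad (V z μ) (X z μ * X z μ - X z μ * X z μ)
    set T2a := Ad (V z μ) (X z μ * Ad (V (z + e μ) ν) (X (z + e μ) ν) - Ad (V (z + e μ) ν) (X (z + e μ) ν) * X z μ)
    set T2b := Ad (V z μ * V (z + e μ) ν) (X (z + e μ) ν * X (z + e μ) ν - X (z + e μ) ν * X (z + e μ) ν)
    set T3a := Ad (V z μ) (X z μ * Ad (V (z + e μ) ν) (X (z + e ν) μ) - Ad (V (z + e μ) ν) (X (z + e ν) μ) * X z μ)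
    set T3b := Ad (V z μ * V (z + e μ) ν) (X (z + e μ) ν * X (z + e ν) μ - X (z + e ν) μ * X (z + e μ) ν)
    set T4a := Ad (V z μ) (X z μ * Ad (V (z + e μ) ν * (V (z + e ν) μ)⁻¹) (X z ν)
        - Ad (V (z + e μ) ν * (V (z + e ν) μ)⁻¹) (X z ν) * X z μ)
    set T4b := Ad (V z μ * V (z + e μ) ν) ((X (z + e μ) ν - X (z + e ν) μ) * Ad (V (z + e ν) μ)⁻¹ (X z ν)
        - Ad (V (z + e ν) μ)⁻¹ (X z ν) * (X (z + e μ) ν - X (z + e ν) μ))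
    have e1 : ‖T1 + (T2a + T2b) - (T3a + T3b) - (T4a + T4b)‖
        ≤ ‖T1 + (T2a + T2b) - (T3a + T3b)‖ + ‖T4a + T4b‖ := norm_sub_le _ _
    have e2 : ‖T1 + (T2a + T2b) - (T3a + T3b)‖ ≤ ‖T1 + (T2a + T2b)‖ + ‖T3a + T3b‖ := norm_sub_le _ _
    have e3 : ‖T1 + (T2a + T2b)‖ ≤ ‖T1‖ + ‖T2a + T2b‖ := norm_add_le _ _
    have e4 : ‖T2a + T2b‖ ≤ ‖T2a‖ + ‖T2b‖ := norm_add_le _ _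
    have e5 : ‖T3a + T3b‖ ≤ ‖T3a‖ + ‖T3b‖ := norm_add_le _ _
    have e6 : ‖T4a + T4b‖ ≤ ‖T4a‖ + ‖T4b‖ := norm_add_le _ _
    linarith
  have hfin : 0 + (2 * (‖X z μ‖ * ‖X (z + e μ) ν‖) + 0)
      + (2 * (‖X z μ‖ * ‖X (z + e ν) μ‖) + 2 * (‖X (z + e μ) ν‖ * ‖X (z + e ν) μ‖))
      + (2 * (‖X z μ‖ * ‖X z ν‖) + 2 * ((‖X (z + e μ) ν‖ + ‖X (z + e ν) μ‖) * ‖X z ν‖))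
      ≤ 3 * bondSqAt X z μ ν := by
    unfold bondSqAt
    nlinarith [sq_nonneg (‖X z μ‖ - ‖X (z + e μ) ν‖), sq_nonneg (‖X z μ‖ - ‖X (z + e ν) μ‖),
      sq_nonneg (‖X (z + e μ) ν‖ - ‖X (z + e ν) μ‖), sq_nonneg (‖X z μ‖ - ‖X z ν‖),
      sq_nonneg (‖X (z + e μ) ν‖ - ‖X z ν‖), sq_nonneg (‖X (z + e ν) μ‖ - ‖X z ν‖)]
  exact hsum.trans hfin

/-- **SMALL-FIELD LOWER BOUND FOR THE HESSIAN DENSITY**: for unitary `V`, skew `X` and a plaquette with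
`‖V(∂p′) − 1‖ ≤ a`:  `hessPlaqAt V X X p′ ≥ ‖(d_V X)(p′)‖²∕N − 7a·Σ_{b⊂∂p′}‖X(b)‖²`. [folklore] -/
theorem hessPlaqAt_self_ge [Nonempty n] {V : Site d → Fin d → (Matrix n n ℂ)ˣ} (hV : IsUnitaryCfg V) {X : Site d → Fin d → Matrix n n ℂ}
    (hX : IsSkewDir X) (z : Site d) (μ ν : Fin d) {a : ℝ}
    (hp : ‖((hol V z (plaqWord μ ν) : (Matrix n n ℂ)ˣ) : Matrix n n ℂ) - 1‖ ≤ a) :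
    ‖curlAt V X z μ ν‖ ^ 2 / (Fintype.card n : ℝ) - 7 * a * bondSqAt X z μ ν ≤ hessPlaqAt V X X z μ ν := by
  rw [hessPlaqAt_self_eq hV hX]
  set D := dcurlAt V X X z μ ν
  set C := curlAt V X z μ ν
  set H := ((hol V z (plaqWord μ ν) : (Matrix n n ℂ)ˣ) : Matrix n n ℂ)
  have h1 : ‖C‖ ^ 2 / (Fintype.card n : ℝ) ≤ nhsNormSq C := opNorm_sq_div_card_le_nhsNormSq C
  have h2 : |nReTr ((D + C * C) * (H - 1))| ≤ ‖D + C * C‖ * ‖H - 1‖ := abs_nReTr_mul_le _ _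
  have h3 : ‖D + C * C‖ ≤ 3 * bondSqAt X z μ ν + 4 * bondSqAt X z μ ν := by
    refine (norm_add_le _ _).trans (add_le_add (norm_dcurlAt_self_le hV X z μ ν) ?_)
    calc ‖C * C‖ ≤ ‖C‖ * ‖C‖ := opNorm_mul_le _ _
      _ = ‖C‖ ^ 2 := by ring
      _ ≤ 4 * bondSqAt X z μ ν := norm_curlAt_sq_le hV X z μ ν
  have hB : 0 ≤ bondSqAt X z μ ν := by unfold bondSqAt; positivity
  have h4 : nReTr ((D + C * C) * (H - 1)) ≤ 7 * a * bondSqAt X z μ ν := by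
    have := (le_abs_self _).trans h2
    have h5 : ‖D + C * C‖ * ‖H - 1‖ ≤ (7 * bondSqAt X z μ ν) * a :=
      mul_le_mul (by linarith) hp (norm_nonneg _) (by linarith)
    linarith
  linarith

/-- **SMALL-FIELD LOWER BOUND FOR THE HESSIAN FORM ON A WINDOW**: for unitary `V` in `SmallField V a` (every
plaquette variable within `a` of `1`) and skew `X`,
`hess V X X W ≥ (1∕N)·Σ_{p∈W} ‖curl V X p‖² − 7a·Σ_{p∈W} bondSq X p`.  The first sum is the coercive «curl» part
(controlled on the constraint-and-gauge tangent space by tangent coercivity), the second the mass-type slack that the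
Landau condition must dominate. [folklore] -/
theorem hess_self_ge [Nonempty n] {V : Site d → Fin d → (Matrix n n ℂ)ˣ} (hV : IsUnitaryCfg V) {X : Site d → Fin d → Matrix n n ℂ}
    (hX : IsSkewDir X) {a : ℝ} (hVa : SmallField V a) (W : Finset (T4AveragingDeficitWall.Plaq d)) :
    (∑ p ∈ W, ‖curl V X p‖ ^ 2) / (Fintype.card n : ℝ) - 7 * a * ∑ p ∈ W, bondSq X p ≤ hess V X X W := by
  unfold hess
  rw [Finset.sum_div, Finset.mul_sum, ← Finset.sum_sub_distrib]
  refine Finset.sum_le_sum fun p _ => ?_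
  exact hessPlaqAt_self_ge hV hX p.1 p.2.1.1 p.2.1.2 (hVa p.1 p.2.1.1 p.2.1.2 (ne_of_lt p.2.2))

end

end Summit.QuantumFields.BalabanUV.T4Continuum.NE3HessBounds
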